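import Mathlib
import Literature.Geometry.Lorentzian.StationaryBlackHoleUniqueness
import Literature.Geometry.Lorentzian.StationaryBlackHoleUniquenessProofs
import Literature.Geometry.Lorentzian.StaticBlackHoleUniqueness
import Literature.Geometry.Lorentzian.IPlusRegular
import HarnessLib

/-!
# NonRotatingBlackHoleUniqueness

Topic `Literature/Geometry/Lorentzian`. Named literature fact(s) relocated by the gate from `Summits/FinalStateConjecture/FinalStateConjecture/Theorems/ZeroEnergyKerrOrBombZeroEnergyRigidityStubNonRotatingUniqueness.lean`
(accept-time relocation of `[cite]`d propositions written inline in a Summits proposal; human ruling 2026-08-15).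
Sources: ChruscielCosta2008, ChruscielCostaHeusler2012.

* `Literature.Geometry.Lorentzian.ChruscielGalloway2010_docStaticUniqueness`
* `Literature.Geometry.Lorentzian.SudarskyWald1993_staticity`
* `Literature.Geometry.Lorentzian.SudarskyWald1993_staticity_perComponent` (component-wise
  surface gravities; implies the previous one, `SudarskyWald1993_staticity_of_perComponent`)
-/

namespace Literature.Geometry.Lorentzian

open Set Function Literature.Geometry.Lorentzian
open scoped Manifold ContDiff Topology

/-- **Staticity of non-rotating black holes (Sudarsky–Wald).**  Let `𝓑` be a four-dimensional
stationary asymptotically flat black-hole space-time (`StationaryAFBlackHole`: complete Killing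
field `T = 𝓑.killing` timelike on `M_ext`, AF end) which is `I⁺`-regular (Chruściel–Costa 2008,
Def. 1.1: `IsIPlusRegular`), vacuum (`Ric(g) = 0`), with non-empty future event horizon
`𝓔⁺ = 𝓑.horizon`, and NON-ROTATING with NON-DEGENERATE horizon in the following sense: `T` has
no zeros on `𝓔⁺` and `∇_T T = κ T` on `𝓔⁺` for one constant `κ ≠ 0`.  Then `T` is
hypersurface-orthogonal on the domain of outer communications `⟨⟨M_ext⟩⟩ = 𝓑.doc`
(`X♭ ∧ dX♭ = 0` there, `IsHypersurfaceOrthogonalOn`), i.e. `⟨⟨M_ext⟩⟩` is static.  (Stated for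
carriers in `Type`, the universe of the route statements it serves.)

Printed: Chruściel–Costa–Heusler 2012, §3.3.1 (standing assumption of §3.3: `I⁺`-regular): "A
Killing horizon is called non-rotating if it is generated by the stationary Killing field … In
the non-rotating case, one continues by showing [Chruściel–Wald 1994] that the domain of outer
communications contains a maximal Cauchy surface. This has been proven so far only for
non-degenerate horizons … This allows one to prove the staticity theorem [Sudarsky–Wald 1992,
1993], that the stationary Killing field of a non-rotating, electrovacuum black-hole spacetime is
hypersurface orthogonal"; the underlying theorem is Sudarsky–Wald 1993, Thm. 1/Thm. 2 ("a
stationary black hole with a bifurcate Killing horizon that has `Ω J_∞ − VQ = 0` [vacuum,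
non-rotating: `Ω = 0`, `Q = 0`] is static"), the bifurcate horizon being attached to the
non-degenerate `𝓔⁺` by Rácz–Wald 1996 and the maximal hypersurface being Chruściel–Wald 1994,
Thm. 4.2; the whole argument is printed for `I⁺`-regular vacuum space-times in Chruściel–Costa
2008, §7.2 ("staticity of `⟨⟨M_ext⟩⟩'` follows. Hence `⟨⟨M_ext⟩⟩` is static as well").
Faithfulness, hypothesis by hypothesis: stationary AF, `I⁺`-regular, (electro)vacuum and
"black hole" (`𝓔⁺ ≠ ∅`) are as printed; the horizon hypothesis implies the printed "non-rotating,
non-degenerate": by the Killing equation `0 = g(∇_T T, T) = κ g(T, T)`, so `T` is NULL and non-zero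
on `𝓔⁺` (`IsKillingField.val_self_eq_zero_of_leviCivita_eq_smul`), `T` is tangent to `𝓔⁺`
(`StationaryAFBlackHole.mem_horizon_of_isMIntegralCurve`), and `𝓔⁺` is smooth (Chruściel–Costa
2008, Thm. 4.11), so `𝓔⁺` is a Killing horizon of the stationary field itself with surface
gravity the constant `κ ≠ 0` (Chruściel–Costa 2008, (2.8): `d(g(T,T)) = −2κ T♭`, tree lemma
`IsKillingField.val_leviCivita_eq_neg_mul_of_leviCivita_eq_smul`).  No analyticity is assumed,
as in print: in CCH12 §3.3.1 analyticity enters only through Hawking's strong rigidity theorem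
("assuming analyticity, SRT asserts that the event horizon of a stationary black-hole spacetime
is a Killing horizon"), which is here the HYPOTHESIS, while the Rácz–Wald extension, the
Chruściel–Wald maximal hypersurface and the Sudarsky–Wald argument are smooth-category theorems
(the same route proves the smooth Theorem 3.5 of CCH12).  The conclusion is staticity of the
d.o.c. ONLY, as printed (nothing is claimed on the black-hole region `M ∖ I⁻(M_ext)`).
Multi-component horizons are allowed in print (CC08 §7.2: "near each connected component of
`𝓔⁺`"); here all components carry the same constant `κ`, a further restriction. [cite: ChruscielCostaHeusler2012, §3.3.1 (the staticity theorem: SudarskyWald1993 Thms. 1–2 on the maximal hypersurface of ChruscielWald1994 Thm. 4.2, bifurcate horizon attached by RaczWald1996; printed in detail for I⁺-regular vacuum holes in ChruscielCosta2008 §7.2)] [file Geometry/Lorentzian/NonRotatingBlackHoleUniqueness] -/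
def SudarskyWald1993_staticity : Prop :=
  ∀ (𝓑 : StationaryAFBlackHole.{0}) [𝓑.metric.HasLeviCivita],
    𝓑.IsIPlusRegular → 𝓑.metric.toPseudoRiemannianMetric.IsRicciFlat → 𝓑.horizon.Nonempty →
    (∀ p ∈ 𝓑.horizon, 𝓑.killing p ≠ 0) →
    (∃ κ : ℝ, κ ≠ 0 ∧ ∀ p ∈ 𝓑.horizon,
      𝓑.metric.leviCivita 𝓑.killing p (𝓑.killing p) = κ • 𝓑.killing p) →
    𝓑.metric.toPseudoRiemannianMetric.IsHypersurfaceOrthogonalOn 𝓑.killing 𝓑.doc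

/-- **Uniqueness of static vacuum black holes without analyticity, for a static domain of outer
communications (Chruściel–Costa 2008 Thm. 1.4 / Chruściel–Galloway 2010 / CCH 2012 Thm. 3.1, in
the form applied in print).**  Let `𝓑` be a four-dimensional stationary asymptotically flat
black-hole space-time (`StationaryAFBlackHole`) which is `I⁺`-regular (`IsIPlusRegular`), vacuum
(`Ric(g) = 0`, smooth, NOT assumed analytic), whose complete stationary Killing field
`T = 𝓑.killing` is hypersurface-orthogonal ON THE DOMAIN OF OUTER COMMUNICATIONS `⟨⟨M_ext⟩⟩`
(`IsHypersurfaceOrthogonalOn T 𝓑.doc`: the d.o.c. is static), with non-empty future event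
horizon.  Then `⟨⟨M_ext⟩⟩` is isometric to the Schwarzschild exterior `{r > 2M}` of some mass
`M > 0` (`IsIsometricToSchwarzschildExterior`; `hF hP hres` are the prelude's standing named facts,
as in `static_black_hole_uniqueness`; carriers in `Type`, as the route statements).

Printed: Chruściel–Costa 2008, Thm. 1.4: "Under the hypotheses of [their §1 standing global
hypotheses: a stationary vacuum four-dimensional space-time containing a spacelike, connected,
acausal hypersurface `S` with `S̄` a topological manifold with boundary, the union of a compact
set and of finitely many AF ends; on `M` a complete stationary Killing vector; `⟨⟨M_ext⟩⟩`
globally hyperbolic; `∂S̄ ⊂ M ∖ ⟨⟨M_ext⟩⟩`], suppose moreover that `(⟨⟨M_ext⟩⟩, g)` is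
analytic and `X` is hypersurface-orthogonal. … If `Σ̂` is of positive energy type, then
`⟨⟨M_ext⟩⟩` is isometric to the domain of outer communications of a Schwarzschild space-time",
APPLIED in the same paper, §7.2, to a space-time of which exactly the d.o.c. has been shown static
("Hence `⟨⟨M_ext⟩⟩` is static as well, and Theorem 1.4 allows us to conclude that `⟨⟨M_ext⟩⟩` is
Schwarzschildian"), and likewise in Chruściel–Costa–Heusler 2012, §3.3.1 ("One can then finish
the argument using Theorem 3.1"); analyticity is removed by Chruściel–Galloway 2010, Thm. 1.1
("`I⁺`-regular stationary d.o.c.s satisfying the null energy condition do not contain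
prehorizons …"; "analyticity … can be removed from the set of hypotheses of the classification
theorems in the static case") with the classification restated as their Thm. 4.1, whose
positive-energy-type proviso holds in space dimension `3` (loc. cit. §4; absent from CCH12
Thm. 3.1).  Faithfulness: `I⁺`-regularity implies every printed global hypothesis (the
hypersurface `S ⊆ ⟨⟨M_ext⟩⟩` of Def. 1.1 is spacelike, connected, acausal, `S̄` is a topological
manifold with boundary, compact modulo finitely many AF ends, `∂S̄ ⊆ 𝓔⁺ ⊆ M ∖ ⟨⟨M_ext⟩⟩`; `T`
complete; `⟨⟨M_ext⟩⟩` globally hyperbolic — indeed CCH12 state Thm. 3.1 under hypotheses WEAKER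
than `I⁺`-regularity); vacuum is electrovacuum with `F = 0`, whose Reissner–Nordström /
Majumdar–Papapetrou conclusion is Schwarzschild, of positive mass because `𝓔⁺ ≠ ∅` (as recorded
at `static_black_hole_uniqueness`).  The ONLY difference with the tree's schema
`static_black_hole_uniqueness IsIPlusRegular` is that staticity is asked on `⟨⟨M_ext⟩⟩` (the
printed APPLIED form above), not on all of `M` (the letter of CCH12 Thm. 3.1, `IsStatic`): the
two are not interderivable in the tree, and only the present form composes with the Sudarsky–Wald
staticity theorem, exactly as in the printed proofs cited. [cite: ChruscielCosta2008, Thm. 1.4 as applied in §7.2; analyticity removed by ChruscielGalloway2010 Thm. 1.1, Thm. 4.1 (= ChruscielCostaHeusler2012 Thm. 3.1, §3.3.1)] [file Geometry/Lorentzian/NonRotatingBlackHoleUniqueness] -/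
def ChruscielGalloway2010_docStaticUniqueness : Prop :=
  ∀ (𝓑 : StationaryAFBlackHole.{0}) [𝓑.metric.HasLeviCivita] [Kerr.Facts]
    (hF : 𝓑.metric.isOpen_chronologicalFuture 𝓑.timeOrientation)
    (hP : 𝓑.metric.isOpen_chronologicalPast 𝓑.timeOrientation)
    (hres : PseudoRiemannianMetric.contMDiff_restrict
      (I := modelWithCornersSelf ℝ (EuclideanSpace ℝ (Fin 4))) (n := ((⊤ : ℕ∞) : WithTop ℕ∞))
      (M := 𝓑.carrier)),
    𝓑.IsIPlusRegular →
    𝓑.metric.toPseudoRiemannianMetric.IsHypersurfaceOrthogonalOn 𝓑.killing 𝓑.doc →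
    𝓑.metric.toPseudoRiemannianMetric.IsRicciFlat → 𝓑.horizon.Nonempty →
    𝓑.IsIsometricToSchwarzschildExterior hF hP hres

/-! ## From a `c • T` witness to the `T` witness -/

/-! ## Sudarsky–Wald staticity with component-wise surface gravities -/

/-- **Staticity of non-rotating black holes, surface gravity PER CONNECTED COMPONENT of the
horizon (Sudarsky–Wald; the multi-component form used in print).**  Same hypotheses and
conclusion as `SudarskyWald1993_staticity` — `𝓑` a four-dimensional stationary AF black-hole
space-time, `I⁺`-regular, vacuum, `𝓔⁺ ≠ ∅`, `T = 𝓑.killing` nowhere zero on `𝓔⁺` — except that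
the non-rotating / non-degenerate horizon hypothesis is imposed component by component: for every
`p ∈ 𝓔⁺` there is a constant `κ ≠ 0` with `∇_T T = κ T` on the connected component
`connectedComponentIn 𝓔⁺ p` of `𝓔⁺` through `p` (so the surface gravities of different components
may differ).  Conclusion: `T` is hypersurface-orthogonal on `⟨⟨M_ext⟩⟩ = 𝓑.doc`.

Printed: the staticity argument of Chruściel–Costa 2008, §7.2 is local near each component of the
horizon ("near each connected component of `𝓔⁺`": Rácz–Wald's bifurcate extension is attached to
each non-degenerate component separately, then the Chruściel–Wald maximal hypersurface and the
Sudarsky–Wald identity give staticity of `⟨⟨M_ext⟩⟩`), and Chruściel–Costa–Heusler 2012 record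
the multi-component consequence explicitly: "A multi-component electro-vacuum configuration with
all components non-degenerate and non-rotating would be, by what has been said, static, but then no
such solutions exist (all components of an MP black hole are degenerate)" (§3, summary of
four-dimensional multi-component solutions, right after §3.3), "by what has been said" referring
to §3.3.1: "In the non-rotating case, one continues by showing [Chruściel–Wald 1994] that the domain
of outer communications contains a maximal Cauchy surface. This has been proven so far only for
non-degenerate horizons … This allows one to prove the staticity theorem [Sudarsky–Wald 1992,
1993], that the stationary Killing field of a non-rotating, electrovacuum black-hole spacetime is
hypersurface orthogonal."  Faithfulness, hypothesis by hypothesis, is as recorded at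
`SudarskyWald1993_staticity` (each component is a non-degenerate Killing horizon of `T` with its
own surface gravity `κ_C ≠ 0`, by `d(g(T,T)) = −2κ_C T♭` on that component); the single-`κ`
tree copy is the special case of a constant family (`SudarskyWald1993_staticity_of_perComponent`,
proved).  Vacuum only (print: electro-vacuum); no analyticity; conclusion on the d.o.c. only.
[cite: ChruscielCostaHeusler2012, §3.3.1 and §3 (multi-component summary): SudarskyWald1993 Thms. 1–2 with ChruscielWald1994 Thm. 4.2 and RaczWald1996, printed for I⁺-regular vacuum holes in ChruscielCosta2008 §7.2] -/
def SudarskyWald1993_staticity_perComponent : Prop :=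
  ∀ (𝓑 : StationaryAFBlackHole.{0}) [𝓑.metric.HasLeviCivita],
    𝓑.IsIPlusRegular → 𝓑.metric.toPseudoRiemannianMetric.IsRicciFlat → 𝓑.horizon.Nonempty →
    (∀ p ∈ 𝓑.horizon, 𝓑.killing p ≠ 0) →
    (∀ p ∈ 𝓑.horizon, ∃ κ : ℝ, κ ≠ 0 ∧ ∀ q ∈ connectedComponentIn 𝓑.horizon p,
      𝓑.metric.leviCivita 𝓑.killing q (𝓑.killing q) = κ • 𝓑.killing q) →
    𝓑.metric.toPseudoRiemannianMetric.IsHypersurfaceOrthogonalOn 𝓑.killing 𝓑.doc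

/-- The component-wise form implies the tree's single-`κ` form `SudarskyWald1993_staticity`
(a constant family of surface gravities). [folklore] -/
theorem SudarskyWald1993_staticity_of_perComponent (h : SudarskyWald1993_staticity_perComponent) :
    SudarskyWald1993_staticity := by
  intro 𝓑 _ hI hRic hne hT hκ
  obtain ⟨κ, hκ0, hκ⟩ := hκ
  exact h 𝓑 hI hRic hne hT fun p _ =>
    ⟨κ, hκ0, fun q hq => hκ q (connectedComponentIn_subset _ _ hq)⟩

end Literature.Geometry.Lorentzian
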